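import Summits.HodgeConjecture.HodgeConjecture.Theorems.R90S4TwistedTubeFormulaLoc                -- ★ (B1-T) part 3′ (K2E3-p12 (g11)): `integrableOn_and_index_mul_setIntegral_epsTube_eq_of_localJacobian` (the one-tube formula under the (3′) letter); brings ★ part 3 p864988, ★ 2a∕2b∕2b′, ★ M1, ★ β
import Summits.HodgeConjecture.HodgeConjecture.Theorems.R90S4TwistedWeylMeasureOfOneTubeFormulas  -- ★ (B1-Σ) core (R90-C131-p03 (g3)): `isTwistedWeylMeasure_stableCartanMeasure_of_oneTubeFormulas … (hwc) (hone)`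
import Summits.HodgeConjecture.HodgeConjecture.Theorems.R90S4EpsNormTubeEqImage                    -- ★ p864960 (T-EQ-IMG, R90-C131-p05 (g3)): `setOf_exists_isEpsNormPair_eq_image_epsTube` (norm tube = `Ψ '' D`)
import Summits.HodgeConjecture.HodgeConjecture.Theorems.R90S4TwistedTubeOrbitalBase                -- ★ β CAN-ID: brings ★ B3-2 `map_apply_compactCore`, `isInvInvariant_map_of_continuousMulEquiv`
import Summits.HodgeConjecture.HodgeConjecture.Theorems.R90S4NormTransversalOfCover                -- ★ (K2E3-p17): `exists_normTransversal_of_cover_splitFormGL` (the norm-one transversal `R`)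
import Summits.HodgeConjecture.HodgeConjecture.Theorems.R90S4BorelNormSection                      -- ★ p864367 (L2): `exists_measurable_epsNormSection`
import Summits.HodgeConjecture.HodgeConjecture.Theorems.R90S4NormStableClassBijection               -- ★ `exists_epsNorm_eq_coe_continuousMulEquiv` (`δ₀` with `N δ₀ = γ₀` and the identity `G̃_{δ₀ε} ≃ₜ* Z(γ₀)`); brings ★ α `mem_centralizer_of_epsNorm_eq_coe`
import Summits.HodgeConjecture.HodgeConjecture.Theorems.F0P3cStCharTSWeylCartanOrbInt               -- ★ (E3): `exists_haar_cartan_compactCore_eq_one` (THE core-one Haar measure of `Z(γ₀)`)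
import HarnessLib

/-!
# R90-TF · S4 «Ch. 13.1–2», T-WIF road, (B1-Σ) head — THE TWISTED WEYL INTEGRATION FORMULA ON THE STABLE CARTAN MEASURE FROM THE TWISTED TUBE JACOBIANS
# (Rogawski 1990, §12.5 p. 186): the (B1) socket of FILE C, paid modulo the ONE (J̃♭) socket

Cell `hodgecm-mathlib`, crux H413 (`stmt-HodgeConjecture-24833`, lane `--supports … --as helper`), route of record `HCCMUnconditional` (no route verbs; count-neutral).
Programme R90-TF, section S4 = [Rogawski1990] Ch. 13.1–13.2.  Seat K2E3-p36 (g4) = (Σ-head) PEN (S4 dealer K2E2-plan (g8), S4-R60 ∕ S4-R66 (a) ∕ S4-R71, 2026-09-05T03:14Z); the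
Σ-core is R90-C131-p03 (g3)'s ★ `R90S4TwistedWeylMeasureOfOneTubeFormulas`, the analytic half is the ★ (B1-T) spine (parts 1∕2a∕2b∕2b′∕3∕3′, R90-C131-p03 (g3) + K2E3-p12 (g11)).
THEOREMS ONLY — no `def`, no instance, no notation, no named-fact hypothesis, no `sorry`; ★-only imports, never `Lines`.

HONEST LABEL: HC_CM is proved only modulo the 7 printed citations (2 remaining named inputs: hLiu418 = stmt-HodgeConjecture-24832, h413 = stmt-HodgeConjecture-24833)
until rung 0 closes.  CONDITIONAL on the per-member TWISTED TUBE JACOBIAN letter (J̃♭) = the ONE socket `stub_R90_S4_twistedTubeJacobian` of C ED. 6 (hypothesis `hJac`, bytes of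
record typ1 (g2) v3.2 :80–:103), on (WEYL-COUNT-T) (`hwc`) and SING-ε (`hsing`), the ε-canonical family (`hepscan`) and a stable-transport dictionary (`hdict`) — all hypotheses;
this file PAYS the (B1) placeholder of FILE C modulo those and discharges no socket by itself (REL ≠ ★ ≠ BUILT).

## The mathematics

§1 `oneTubeFormula_of_twistedTubeJacobian` — THE ONE-TUBE FORMULA OF A MEMBER `T = Z(γ₀)` FROM ITS TWISTED TUBE JACOBIAN.  The (J̃♭) letter (3′) is universally quantified over
its apparatus (an ε-regular base point `δ₀ ∈ T̃ = Cent_{G̃_v}(γ₀)` with the core-one Haar measure `τ'` of `T′ = G̃_{δ₀ε}`, the twisted family `Ψ(xT′, b) = x b ε(x)⁻¹`, an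
ε-normaliser `Ñ`, a Borel norm section `s : T → T̃`, a norm-one transversal `R` of `T̃ᴺ` modulo `(1−ε)T̃`, a core-one Haar measure of `T`).  We CHOOSE the apparatus from ★:
`δ₀` with `N δ₀ = γ₀` ON THE NOSE together with the identity `e : G̃_{δ₀ε} ≃ₜ* Z_{G_v}(γ₀)` (★ `exists_epsNorm_eq_coe_continuousMulEquiv`; `δ₀ ∈ T̃` ★ α, ε-regular because
`N δ₀ = γ₀` is regular), `τ' := (e⁻¹)_* ρ₀` for THE core-one Haar measure `ρ₀` of `Z(γ₀)` (★ (E3); Haar, inversion invariant, core-one along `e` ★ B3-2), `Ψ` ★ M1, `s` ★ (L2),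
`R` ★ `exists_normTransversal_of_cover_splitFormGL`; the ε-normaliser `Ñ` is the one-tube formula's own binder.  Feeding the letter at this apparatus to ★ part 3′
`integrableOn_and_index_mul_setIntegral_epsTube_eq_of_localJacobian` gives, for `φβ` integrable with `β` ε-stable and any norm section `sec₀`:
`t ↦ D_T(t) • Φ^{st}_ε(sec₀ t, φ) β(sec₀ t)` is `t_T`-integrable on `T^{reg}` and `[Ñ : T̃] · ∫_{Ψ(D)} φβ dνGt = ∫_{T^{reg}} D_T(t) • Φ^{st}_ε(sec₀ t, φ) β(sec₀ t) dt_T`; and ★ (T-EQ-IMG)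
`Ψ(D) = {δ | ∃ t ∈ T^{reg}, t ∈ 𝒩(δ)}` puts the left side in the NORM-TUBE currency of Σ-core's `hone` — byte for byte.
§2 `isTwistedWeylMeasure_stableCartanMeasure_of_twistedTubeJacobians` — THE (B1) HEAD: Σ-core ★ `isTwistedWeylMeasure_stableCartanMeasure_of_oneTubeFormulas` with `hone := §1` at
every member: **`IsTwistedWeylMeasure L Φ₃ v νGt mGt (stableCartanMeasure L v C tT n) sec₀`** — «`∫_{G̃_v} φβ dνGt = ∫ Φ^{st}_ε(sec₀ γ, φ) β(sec₀ γ) dρ(γ)`» (p. 186 regrouped on the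
stable Cartan measure of p. 182), the `hT` input of ★ p863508 `weylNormPair_of_stable_twisted` ((W-NP) ↓).

[cite: Rogawski1990, §12.5 pp. 182, 186–187; §4.3 (4.3.1) p. 43; §3.11 Prop. 3.11.1–3.11.2 pp. 34–35] [cite: HarishChandra1970, Lemma 22; Lemma 42]
-/

set_option autoImplicit false
-- the mandated namespace repeats the single-problem summit's segment (`HodgeConjecture.HodgeConjecture`)
set_option linter.dupNamespace false

noncomputable section

open MeasureTheory Measure Set Filter Topology Function NumberField IsDedekindDomain
open scoped ENNReal NNReal MatrixGroups Pointwise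

namespace Summit.HodgeConjecture.HodgeConjecture.R90.S4

open Literature.NumberTheory.Rogawski1990 Literature.NumberTheory.Rogawski1990.Ch4Sec10
open Literature.NumberTheory.Automorphic Literature.NumberTheory.Automorphic.UnitaryGroup
open Literature.MeasureTheory.Group
open Summit.HodgeConjecture.HodgeConjecture.Cruxes.H413.F0P3cStCharTSWeylCartanOrbInt

section SigmaHead

variable {L : Type} [Field L] [NumberField L] [IsCMField L] {v : HeightOneSpectrum (𝓞 ↥(maximalRealSubfield L))}

/-! ## §1 The one-tube formula of a member from its twisted tube Jacobian -/

set_option maxHeartbeats 800000 in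
-- instance-term unification on the CM local carrier (`G̃_v ⧸ T′`, `quotientMeasure`), as in ★ (B1-T) parts 2b∕3∕3′
/-- **THE ONE-TUBE FORMULA OF A CARTAN `T = Z(γ₀)` FROM ITS TWISTED TUBE JACOBIAN** (Rogawski p. 186 for one Cartan).  HYPOTHESIS `hJacT` = the (J̃♭) letter (3′) of FILE C's ONE
socket `stub_R90_S4_twistedTubeJacobian` at `T` (typ1 (g2) v3.2 :80–:103 bytes after `(i) (γ₀) (hγ₀) (hT)`, universally quantified over the apparatus `δ₀ τ' Ψ Ñ s R t_T`).  CONCLUSION =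
the body of Σ-core's `hone` at `T`, byte for byte: for every ε-normaliser `Ñ` of `T̃ = Cent_{G̃_v}(γ₀)`, every `νGt`-integrable `φβ` with `β` an ε-stable class function and every norm
section `sec₀`: `t ↦ D_T(t) • (Φ^{st}_ε(sec₀ t, φ) · β(sec₀ t))` is `t_T`-integrable on `T^{reg}` and
`[Ñ : T̃] · ∫_{{δ | ∃ t ∈ T^{reg}, t ∈ 𝒩(δ)}} φ β dνGt = ∫_{T^{reg}} D_T(t) • (Φ^{st}_ε(sec₀ t, φ) · β(sec₀ t)) dt_T`.  PROOF: choose the apparatus from ★ (module docstring §1), feed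
`hJacT`, apply ★ part 3′ `integrableOn_and_index_mul_setIntegral_epsTube_eq_of_localJacobian`, and rewrite `Ψ(D)` into the norm tube by ★ (T-EQ-IMG).
[cite: Rogawski1990, §12.5 p. 186; §4.3 (4.3.1) p. 43; §3.11 Prop. 3.11.1–3.11.2 pp. 34–35] [cite: HarishChandra1970, Lemma 22; Lemma 42] -/
theorem oneTubeFormula_of_twistedTubeJacobian (hns : ∀ w : PlacesOver L v, IsCMField.complexConj L • w.1 = w.1)
    [LocallyCompactSpace (GtLoc L v)] [SecondCountableTopology (GtLoc L v)] [T2Space (GtLoc L v)] [MeasurableSpace (GtLoc L v)] [BorelSpace (GtLoc L v)]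
    [∀ δ : GtLoc L v, MeasurableSpace (GtLoc L v ⧸ epsCentralizer (epsLoc L (splitFormGL L) v) δ)]
    [∀ δ : GtLoc L v, BorelSpace (GtLoc L v ⧸ epsCentralizer (epsLoc L (splitFormGL L) v) δ)]
    [MeasurableSpace (Gqs L v)] [BorelSpace (Gqs L v)]
    (νGt : Measure (GtLoc L v)) [νGt.IsHaarMeasure] [νGt.IsMulRightInvariant]
    (mGt : EpsOrbitalMeasureFamily (epsLoc L (splitFormGL L) v) ⊥) (hcan : IsEpsCanonicalAt L (splitFormGL L) v νGt mGt)
    {T : Subgroup (Gqs L v)} (γ₀ : Gqs L v) (hγ₀ : IsRegularElt (γ₀.val : GtLoc L v)) (hT : T = Subgroup.centralizer ({γ₀} : Set (Gqs L v)))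
    (tT : Measure ↥T) [tT.IsHaarMeasure] [tT.IsInvInvariant] (htc : tT (compactCore ↥T) = 1)
    (hJacT : ∀ ⦃δ₀ : GtLoc L v⦄ (hδ₀T : δ₀ ∈ Subgroup.centralizer ({(γ₀.val : GtLoc L v)} : Set (GtLoc L v))) (hδ₀reg : IsEpsRegularAt L (splitFormGL L) v δ₀)
      (τ' : Measure ↥(epsCentralizer (epsLoc L (splitFormGL L) v) δ₀)) [τ'.IsHaarMeasure] [τ'.IsInvInvariant]
      (h1 : τ' (compactCore ↥(epsCentralizer (epsLoc L (splitFormGL L) v) δ₀)) = 1)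
      (Ψ : (GtLoc L v ⧸ epsCentralizer (epsLoc L (splitFormGL L) v) δ₀) × ↥(Subgroup.centralizer ({(γ₀.val : GtLoc L v)} : Set (GtLoc L v))) → GtLoc L v)
      (hΨ : ∀ (x : GtLoc L v) (b : ↥(Subgroup.centralizer ({(γ₀.val : GtLoc L v)} : Set (GtLoc L v)))), Ψ (QuotientGroup.mk x, b) = x * b * (epsLoc L (splitFormGL L) v x)⁻¹)
      (N' : Subgroup (GtLoc L v))
      (hN' : ∀ m, m ∈ N' ↔ m ∈ Subgroup.normalizer ((Subgroup.centralizer ({(γ₀.val : GtLoc L v)} : Set (GtLoc L v)) : Subgroup (GtLoc L v)) : Set (GtLoc L v)) ∧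
        m * (epsLoc L (splitFormGL L) v m)⁻¹ ∈ Subgroup.centralizer ({(γ₀.val : GtLoc L v)} : Set (GtLoc L v)))
      (s : ↥T → ↥(Subgroup.centralizer ({(γ₀.val : GtLoc L v)} : Set (GtLoc L v)))) (hsm : Measurable s)
      (hsN : ∀ t : ↥T, epsNorm (epsLoc L (splitFormGL L) v) (s t : GtLoc L v) = ((t : Gqs L v)).val)
      (R : Finset ↥(Subgroup.centralizer ({(γ₀.val : GtLoc L v)} : Set (GtLoc L v))))
      (hRN : ∀ u ∈ R, epsNorm (epsLoc L (splitFormGL L) v) (u : GtLoc L v) = 1)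
      (hRcov : ∀ w : ↥(Subgroup.centralizer ({(γ₀.val : GtLoc L v)} : Set (GtLoc L v))), epsNorm (epsLoc L (splitFormGL L) v) (w : GtLoc L v) = 1 →
        ∃ u ∈ R, ∃ a : ↥(Subgroup.centralizer ({(γ₀.val : GtLoc L v)} : Set (GtLoc L v))), (w : GtLoc L v) = u * (a * (epsLoc L (splitFormGL L) v a)⁻¹))
      (hRinj : ∀ u ∈ R, ∀ u' ∈ R, (∃ a : ↥(Subgroup.centralizer ({(γ₀.val : GtLoc L v)} : Set (GtLoc L v))),
        ((u' : ↥(Subgroup.centralizer ({(γ₀.val : GtLoc L v)} : Set (GtLoc L v)))) : GtLoc L v) = u * (a * (epsLoc L (splitFormGL L) v a)⁻¹)) → u = u')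
      (tT' : Measure ↥T) [tT'.IsHaarMeasure] [tT'.IsInvInvariant] (htc' : tT' (compactCore ↥T) = 1),
      ∀ b₁ ∈ {b : ↥(Subgroup.centralizer ({(γ₀.val : GtLoc L v)} : Set (GtLoc L v))) | ∃ t : ↥T, IsRegularElt (((t : Gqs L v)).val : GtLoc L v) ∧ ∃ u ∈ R, b = s t * u},
        ∃ U' : Set ↥(Subgroup.centralizer ({(γ₀.val : GtLoc L v)} : Set (GtLoc L v))), IsOpen U' ∧ b₁ ∈ U' ∧
        ∃ A₀ : Set (GtLoc L v ⧸ epsCentralizer (epsLoc L (splitFormGL L) v) δ₀), MeasurableSet A₀ ∧ (quotientMeasure (epsCentralizer (epsLoc L (splitFormGL L) v) δ₀) τ' (isClosed_epsCentralizer L (splitFormGL L) v δ₀) νGt) A₀ ≠ 0 ∧ (quotientMeasure (epsCentralizer (epsLoc L (splitFormGL L) v) δ₀) τ' (isClosed_epsCentralizer L (splitFormGL L) v δ₀) νGt) A₀ ≠ ⊤ ∧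
          ∀ u ∈ R, ∀ V : Set ↥T, MeasurableSet V → V ⊆ {t : ↥T | IsRegularElt (((t : Gqs L v)).val : GtLoc L v)} → (fun t : ↥T => s t * u) '' V ⊆ U' →
            νGt (Ψ '' (A₀ ×ˢ ((fun t : ↥T => s t * u) '' V))) = (quotientMeasure (epsCentralizer (epsLoc L (splitFormGL L) v) δ₀) τ' (isClosed_epsCentralizer L (splitFormGL L) v δ₀) νGt) A₀ * ∫⁻ t in V, (cartanWeight L v T t : ℝ≥0∞) ∂tT')
    (N' : Subgroup (GtLoc L v))
    (hN' : ∀ m : GtLoc L v, m ∈ N' ↔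
      m ∈ Subgroup.normalizer ((Subgroup.centralizer ({(γ₀.val : GtLoc L v)} : Set (GtLoc L v))) : Set (GtLoc L v)) ∧ m * (epsLoc L (splitFormGL L) v m)⁻¹ ∈ (Subgroup.centralizer ({(γ₀.val : GtLoc L v)} : Set (GtLoc L v))))
    (φ β : GtLoc L v → ℂ) (hφβ : Integrable (fun y => φ y * β y) νGt)
    (hβ : ∀ δ δ' : GtLoc L v, IsStablyEpsConjAt L (splitFormGL L) v δ δ' → β δ = β δ')
    (sec₀ : Gqs L v → GtLoc L v) (hsec₀ : ∀ γ : Gqs L v, IsEpsNormPair L (splitFormGL L) v (sec₀ γ) γ) :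
    IntegrableOn (fun t : ↥T => (cartanWeight L v T t : ℝ) •
        (stableEpsOrbitalIntegral L (splitFormGL L) v mGt φ (sec₀ (t : Gqs L v)) * β (sec₀ (t : Gqs L v))))
      {t : ↥T | IsRegularElt (((t : Gqs L v)).val : GL (Fin 3) (LocalRing L v))} tT ∧
    ((((Subgroup.centralizer ({(γ₀.val : GtLoc L v)} : Set (GtLoc L v))).subgroupOf N').index : ℕ) : ℂ) * ∫ y in {δ : GtLoc L v | ∃ t : ↥T, IsRegularElt (((t : Gqs L v)).val : GL (Fin 3) (LocalRing L v)) ∧ IsEpsNormPair L (splitFormGL L) v δ (t : Gqs L v)}, φ y * β y ∂νGt =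
      ∫ t in {t : ↥T | IsRegularElt (((t : Gqs L v)).val : GL (Fin 3) (LocalRing L v))}, (cartanWeight L v T t : ℝ) •
        (stableEpsOrbitalIntegral L (splitFormGL L) v mGt φ (sec₀ (t : Gqs L v)) * β (sec₀ (t : Gqs L v))) ∂tT := by
  classical
  have hΦ := splitFormGL_isHermitian L
  -- `T` is a closed subgroup of the lcsc `G_v`: its Haar measure is σ-finite (needed by ★ part 3′)
  haveI : LocallyCompactSpace (Gqs L v) := locallyCompactSpace_cmDatum_local (L := L) (N := 3) (H := (splitFormGL L : Matrix (Fin 3) (Fin 3) L)) (v := v)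
  haveI : SecondCountableTopology (GL (Fin 3) (LocalRing L v)) := secondCountableTopology_localGL (E := L) 3 v
  haveI : SecondCountableTopology (Gqs L v) := TopologicalSpace.Subtype.secondCountableTopology _
  have hTcl : IsClosed (T : Set (Gqs L v)) := by rw [hT]; exact Set.isClosed_centralizer _
  haveI : LocallyCompactSpace ↥T := hTcl.isClosedEmbedding_subtypeVal.locallyCompactSpace
  haveI : SecondCountableTopology ↥T := TopologicalSpace.Subtype.secondCountableTopology _
  haveI : SigmaCompactSpace ↥T := sigmaCompactSpace_of_locallyCompact_secondCountable
  haveI : SigmaFinite tT := SigmaFinite.of_isFiniteMeasureOnCompacts _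
  -- (a) an ε-regular base point `δ₀ ∈ T̃` with `N δ₀ = γ₀` and the identity `G̃_{δ₀ε} ≃ₜ* Z(γ₀)`
  obtain ⟨δ₀, e, hN₀, -⟩ := exists_epsNorm_eq_coe_continuousMulEquiv L (splitFormGL L) v hΦ γ₀
  have hδ₀T : δ₀ ∈ Subgroup.centralizer ({(γ₀.val : GtLoc L v)} : Set (GtLoc L v)) := mem_centralizer_of_epsNorm_eq_coe hΦ hN₀
  have hδ₀reg : IsEpsRegularAt L (splitFormGL L) v δ₀ := by
    rw [isEpsRegularAt_iff, hN₀]; exact hγ₀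
  -- (b) THE core-one Haar measure of `T′ = G̃_{δ₀ε}`: transported from `Z(γ₀)` along `e⁻¹`
  obtain ⟨ρ₀, hρH, hρI, hρ1⟩ := exists_haar_cartan_compactCore_eq_one (T := Subgroup.centralizer ({γ₀} : Set (Gqs L v))) hγ₀ rfl
  haveI := hρH; haveI := hρI
  haveI : (Measure.map e.symm ρ₀).IsHaarMeasure := e.symm.isHaarMeasure_map ρ₀
  haveI : (Measure.map e.symm ρ₀).IsInvInvariant := isInvInvariant_map_of_continuousMulEquiv e.symm e.symm.continuous.measurable ρ₀
  have h1 : (Measure.map e.symm ρ₀) (compactCore ↥(epsCentralizer (epsLoc L (splitFormGL L) v) δ₀)) = 1 := by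
    rw [map_apply_compactCore e.symm ρ₀, hρ1]
  -- (c) the twisted family `Ψ(xT′, b) = x b ε(x)⁻¹` (`T′` is ε-fixed pointwise and lies in the abelian `T̃`)
  obtain ⟨Ψ, hΨ⟩ := exists_twistedConjFamily (epsLoc L (splitFormGL L) v) (Subgroup.centralizer ({(γ₀.val : GtLoc L v)} : Set (GtLoc L v)))
    (epsCentralizer (epsLoc L (splitFormGL L) v) δ₀) (fun u hu => ((mem_epsCentralizer_base_iff hγ₀ hδ₀T hδ₀reg u).1 hu).2)
    (fun u hu t ht => mul_comm_of_mem_centralizer_of_isRegularElt hγ₀ ((mem_epsCentralizer_base_iff hγ₀ hδ₀T hδ₀reg u).1 hu).1 ht)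
  -- (d) a Borel norm section `s : T → T̃` (★ (L2))
  obtain ⟨s₀, hs₀m, hs₀⟩ := exists_measurable_epsNormSection L v γ₀ T (SetLike.coe_subset_coe.mpr hT.le)
  let s : ↥T → ↥(Subgroup.centralizer ({(γ₀.val : GtLoc L v)} : Set (GtLoc L v))) := fun t => ⟨s₀ t, (hs₀ t).1⟩
  have hsm : Measurable s := hs₀m.subtype_mk
  have hsN : ∀ t : ↥T, epsNorm (epsLoc L (splitFormGL L) v) (s t : GtLoc L v) = ((t : Gqs L v)).val := fun t => (hs₀ t).2
  -- (e) a norm-one transversal `R` of `T̃ᴺ` modulo `(1−ε)T̃`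
  obtain ⟨R, hRN, hRcov, hRinj⟩ := exists_normTransversal_of_cover_splitFormGL hns hγ₀
  -- the socket letter at this apparatus, then ★ part 3′ (the one-tube formula under (3′))
  have hJacL := hJacT hδ₀T hδ₀reg (Measure.map e.symm ρ₀) h1 Ψ hΨ N' hN' s hsm hsN R hRN hRcov hRinj tT htc
  obtain ⟨hint, heq⟩ := integrableOn_and_index_mul_setIntegral_epsTube_eq_of_localJacobian hns hγ₀ hT hδ₀T hδ₀reg Ψ hΨ N' hN' s hsm hsN R hRN hRcov hRinj
    tT (Measure.map e.symm ρ₀) νGt mGt hcan h1 hJacL φ β hφβ.integrableOn hβ sec₀ hsec₀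
  refine ⟨hint, ?_⟩
  -- ★ (T-EQ-IMG): the norm tube over `T^{reg}` IS `Ψ '' D`
  have hset : {δ : GtLoc L v | ∃ t : ↥T, IsRegularElt (((t : Gqs L v)).val : GL (Fin 3) (LocalRing L v)) ∧ IsEpsNormPair L (splitFormGL L) v δ (t : Gqs L v)} =
      Ψ '' {p | p.2 ∈ {b : ↥(Subgroup.centralizer ({(γ₀.val : GtLoc L v)} : Set (GtLoc L v))) |
        ∃ t : ↥T, IsRegularElt (((t : Gqs L v)).val : GtLoc L v) ∧ ∃ u ∈ R, b = s t * u}} :=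
    setOf_exists_isEpsNormPair_eq_image_epsTube hγ₀ hT Ψ hΨ s hsN R hRN hRcov
  rw [hset]
  exact heq

end SigmaHead

section SigmaHeadFinal

variable (L : Type) [Field L] [NumberField L] [IsCMField L] (v : HeightOneSpectrum (𝓞 ↥(maximalRealSubfield L)))

/-! ## §2 The (B1) head: the twisted Weyl integration formula on the stable Cartan measure -/

set_option maxHeartbeats 800000 in
-- instance-term unification on the CM local carrier, as in §1 and the socket frame of FILE C
/-- **(B1) — THE TWISTED WEYL INTEGRATION FORMULA ON THE STABLE CARTAN MEASURE, FROM THE TWISTED TUBE JACOBIANS** (Rogawski §12.5 p. 186, regrouped over the stable classes of Cartan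
subgroups as on p. 182).  `v` non-split (`hns`); `νGt` a Haar measure on `G̃_v`, `mGt` an ε-CANONICAL family for it (`hepscan`); `C` a Cartan system with the ★ CARTAN-ALL letters `hZ`,
`hcov`, `hirr`; `tT` core-one inversion-invariant Haar measures on the members; `(C, n)` with a stable-transport dictionary (`hdict`); THE PER-MEMBER TWISTED TUBE JACOBIAN LETTER (J̃♭)
`hJac` = FILE C's ONE socket `stub_R90_S4_twistedTubeJacobian` after `νGt`, at `T := ↑i` (typ1 (g2) v3.2 :80–:103 bytes); SING-ε (`hsing`); (WEYL-COUNT-T) (`hwc`); any everywhere-norm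
section `sec₀`.  THEN **`IsTwistedWeylMeasure L (splitFormGL L) v νGt mGt (stableCartanMeasure L v C tT n) sec₀`**: for `φ ∈ C_c^∞(G̃_v)` and continuous ε-stable `β`,
`∫_{G̃_v} φ β dνGt = ∫ Φ^{st}_ε(sec₀ γ, φ) β(sec₀ γ) d(stableCartanMeasure)(γ)` — the `hT` input of ★ p863508 `weylNormPair_of_stable_twisted`.  PROOF: ★ Σ-core
`isTwistedWeylMeasure_stableCartanMeasure_of_oneTubeFormulas` with `hone i := §1` at `T := ↑i`, `tT := tT i`, `hJacT := hJac i γ₀ hγ₀ hT`.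
[cite: Rogawski1990, §12.5 pp. 182, 186–187; §4.3 (4.3.1) p. 43; §3.6 pp. 28–31; §3.11 Prop. 3.11.1–3.11.2 pp. 34–35] [cite: HarishChandra1970, Lemma 22; Lemma 42] -/
theorem isTwistedWeylMeasure_stableCartanMeasure_of_twistedTubeJacobians (hns : ∀ w : PlacesOver L v, IsCMField.complexConj L • w.1 = w.1)
    [LocallyCompactSpace (GtLoc L v)] [SecondCountableTopology (GtLoc L v)] [T2Space (GtLoc L v)]
    [MeasurableSpace (GtLoc L v)] [BorelSpace (GtLoc L v)] [MeasurableSpace (Gqs L v)] [BorelSpace (Gqs L v)]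
    [∀ δ : GtLoc L v, MeasurableSpace (GtLoc L v ⧸ epsCentralizer (epsLoc L (splitFormGL L) v) δ)]
    [∀ δ : GtLoc L v, BorelSpace (GtLoc L v ⧸ epsCentralizer (epsLoc L (splitFormGL L) v) δ)]
    {C : Finset (Subgroup (Gqs L v))}
    (hZ : ∀ T ∈ C, ∃ γ₀ : Gqs L v, IsRegularElt (γ₀.val : GL (Fin 3) (LocalRing L v)) ∧ T = Subgroup.centralizer ({γ₀} : Set (Gqs L v)))
    (hcov : ∀ γ : Gqs L v, IsRegularElt (γ.val : GL (Fin 3) (LocalRing L v)) →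
      ∃ T ∈ C, ∃ x : Gqs L v, ∀ g : Gqs L v, g ∈ Subgroup.centralizer ({γ} : Set (Gqs L v)) ↔ x⁻¹ * g * x ∈ T)
    (hirr : ∀ T ∈ C, ∀ T' ∈ C, T ≠ T' → ∀ y : Gqs L v, ¬ ∀ h : Gqs L v, h ∈ T' ↔ y⁻¹ * h * y ∈ T)
    (tT : ∀ i : ↥C, Measure ↥(i : Subgroup (Gqs L v))) (htH : ∀ i : ↥C, (tT i).IsHaarMeasure) (htI : ∀ i : ↥C, (tT i).IsInvInvariant)
    (htc : ∀ i : ↥C, tT i (compactCore ↥(i : Subgroup (Gqs L v))) = 1)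
    {n : Gqs L v → ℕ} (hdict : IsStableTransportDict L v C n)
    (νGt : Measure (GtLoc L v)) [νGt.IsHaarMeasure] [νGt.IsMulRightInvariant]
    (hsing : νGt {δ : GtLoc L v | ¬ IsEpsRegularAt L (splitFormGL L) v δ} = 0)
    (mGt : EpsOrbitalMeasureFamily (epsLoc L (splitFormGL L) v) ⊥) (hepscan : IsEpsCanonicalAt L (splitFormGL L) v νGt mGt)
    (sec₀ : Gqs L v → GtLoc L v) (hsec₀ : ∀ γ : Gqs L v, IsEpsNormPair L (splitFormGL L) v (sec₀ γ) γ)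
    (hwc : IsTwistedWeylCountT L v C n)
    -- (J̃♭)_i : the twisted tube Jacobian letter (3′) at every member — FILE C's ONE socket after `νGt`, at `T := ↑i` (typ1 (g2) v3.2 :80–:103)
    (hJac : ∀ (i : ↥C) (γ₀ : Gqs L v) (hγ₀ : IsRegularElt (γ₀.val : GtLoc L v))
      (hT : (i : Subgroup (Gqs L v)) = Subgroup.centralizer ({γ₀} : Set (Gqs L v)))
      ⦃δ₀ : GtLoc L v⦄ (hδ₀T : δ₀ ∈ Subgroup.centralizer ({(γ₀.val : GtLoc L v)} : Set (GtLoc L v))) (hδ₀reg : IsEpsRegularAt L (splitFormGL L) v δ₀)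
      (τ' : Measure ↥(epsCentralizer (epsLoc L (splitFormGL L) v) δ₀)) [τ'.IsHaarMeasure] [τ'.IsInvInvariant]
      (h1 : τ' (compactCore ↥(epsCentralizer (epsLoc L (splitFormGL L) v) δ₀)) = 1)
      (Ψ : (GtLoc L v ⧸ epsCentralizer (epsLoc L (splitFormGL L) v) δ₀) × ↥(Subgroup.centralizer ({(γ₀.val : GtLoc L v)} : Set (GtLoc L v))) → GtLoc L v)
      (hΨ : ∀ (x : GtLoc L v) (b : ↥(Subgroup.centralizer ({(γ₀.val : GtLoc L v)} : Set (GtLoc L v)))), Ψ (QuotientGroup.mk x, b) = x * b * (epsLoc L (splitFormGL L) v x)⁻¹)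
      (N' : Subgroup (GtLoc L v))
      (hN' : ∀ m, m ∈ N' ↔ m ∈ Subgroup.normalizer ((Subgroup.centralizer ({(γ₀.val : GtLoc L v)} : Set (GtLoc L v)) : Subgroup (GtLoc L v)) : Set (GtLoc L v)) ∧
        m * (epsLoc L (splitFormGL L) v m)⁻¹ ∈ Subgroup.centralizer ({(γ₀.val : GtLoc L v)} : Set (GtLoc L v)))
      (s' : ↥(i : Subgroup (Gqs L v)) → ↥(Subgroup.centralizer ({(γ₀.val : GtLoc L v)} : Set (GtLoc L v)))) (hs'm : Measurable s')
      (hs'N : ∀ t : ↥(i : Subgroup (Gqs L v)), epsNorm (epsLoc L (splitFormGL L) v) (s' t : GtLoc L v) = ((t : Gqs L v)).val)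
      (R : Finset ↥(Subgroup.centralizer ({(γ₀.val : GtLoc L v)} : Set (GtLoc L v))))
      (hRN : ∀ u ∈ R, epsNorm (epsLoc L (splitFormGL L) v) (u : GtLoc L v) = 1)
      (hRcov : ∀ w : ↥(Subgroup.centralizer ({(γ₀.val : GtLoc L v)} : Set (GtLoc L v))), epsNorm (epsLoc L (splitFormGL L) v) (w : GtLoc L v) = 1 →
        ∃ u ∈ R, ∃ a : ↥(Subgroup.centralizer ({(γ₀.val : GtLoc L v)} : Set (GtLoc L v))), (w : GtLoc L v) = u * (a * (epsLoc L (splitFormGL L) v a)⁻¹))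
      (hRinj : ∀ u ∈ R, ∀ u' ∈ R, (∃ a : ↥(Subgroup.centralizer ({(γ₀.val : GtLoc L v)} : Set (GtLoc L v))),
        ((u' : ↥(Subgroup.centralizer ({(γ₀.val : GtLoc L v)} : Set (GtLoc L v)))) : GtLoc L v) = u * (a * (epsLoc L (splitFormGL L) v a)⁻¹)) → u = u')
      (tT' : Measure ↥(i : Subgroup (Gqs L v))) [tT'.IsHaarMeasure] [tT'.IsInvInvariant] (htc' : tT' (compactCore ↥(i : Subgroup (Gqs L v))) = 1),
      ∀ b₁ ∈ {b : ↥(Subgroup.centralizer ({(γ₀.val : GtLoc L v)} : Set (GtLoc L v))) | ∃ t : ↥(i : Subgroup (Gqs L v)), IsRegularElt (((t : Gqs L v)).val : GtLoc L v) ∧ ∃ u ∈ R, b = s' t * u},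
        ∃ U' : Set ↥(Subgroup.centralizer ({(γ₀.val : GtLoc L v)} : Set (GtLoc L v))), IsOpen U' ∧ b₁ ∈ U' ∧
        ∃ A₀ : Set (GtLoc L v ⧸ epsCentralizer (epsLoc L (splitFormGL L) v) δ₀), MeasurableSet A₀ ∧ (quotientMeasure (epsCentralizer (epsLoc L (splitFormGL L) v) δ₀) τ' (isClosed_epsCentralizer L (splitFormGL L) v δ₀) νGt) A₀ ≠ 0 ∧ (quotientMeasure (epsCentralizer (epsLoc L (splitFormGL L) v) δ₀) τ' (isClosed_epsCentralizer L (splitFormGL L) v δ₀) νGt) A₀ ≠ ⊤ ∧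
          ∀ u ∈ R, ∀ V : Set ↥(i : Subgroup (Gqs L v)), MeasurableSet V → V ⊆ {t : ↥(i : Subgroup (Gqs L v)) | IsRegularElt (((t : Gqs L v)).val : GtLoc L v)} → (fun t : ↥(i : Subgroup (Gqs L v)) => s' t * u) '' V ⊆ U' →
            νGt (Ψ '' (A₀ ×ˢ ((fun t : ↥(i : Subgroup (Gqs L v)) => s' t * u) '' V))) = (quotientMeasure (epsCentralizer (epsLoc L (splitFormGL L) v) δ₀) τ' (isClosed_epsCentralizer L (splitFormGL L) v δ₀) νGt) A₀ * ∫⁻ t in V, (cartanWeight L v (i : Subgroup (Gqs L v)) t : ℝ≥0∞) ∂tT') :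
    IsTwistedWeylMeasure L (splitFormGL L) v νGt mGt (stableCartanMeasure L v C tT n) sec₀ :=
  isTwistedWeylMeasure_stableCartanMeasure_of_oneTubeFormulas L v hns hZ hcov hirr tT htH htc hdict νGt hsing mGt sec₀ hsec₀ hwc
    fun i γ₀ hγ₀ hT N' hN' φ β hφβ hβ => by
      haveI := htH i
      haveI := htI i
      exact oneTubeFormula_of_twistedTubeJacobian hns νGt mGt hepscan γ₀ hγ₀ hT (tT i) (htc i) (hJac i γ₀ hγ₀ hT) N' hN' φ β hφβ hβ sec₀ hsec₀

end SigmaHeadFinal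

end Summit.HodgeConjecture.HodgeConjecture.R90.S4

end
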